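import Summits.Ventures.YMGap.FlowData.KernelMeanVarianceExpansion
import HarnessLib

/-!
# Venture YMGap, track Y3 FLOW-DATA — mean, row variance and the `⟪w, T w⟫` term of a kernel that is a THIRD-order
# polynomial in the coupling up to a quartic remainder (abstract probability space; theorems only)

HONEST FRAMING: venture file of the cell `pub-ymgap` (QuantumFields programme), track Y3 (FLOW-DATA); an abstract
measure-theoretic lemma (no lattice object), the third-order companion of `FlowData/KernelMeanVarianceExpansion.lean` and the
bookkeeping step between `FlowData/RankOneThirdOrder.lean` (`λ_max ≈ t + (2 − t)‖w‖² + ⟪w, T w⟫`, `t = ⟪1,T1⟫`, `w = T1 − t 1`)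
and the third-order strong-coupling laws of the tube.  If a kernel `K` on a probability space satisfies
`|K(a,b) − 1 − J φ₁ − (J²/2) φ₂ − (J³/6) φ₃| ≤ ε` pointwise with `|φ_j| ≤ cʲ`, then with `t = ∫∫K`, `m_j = ∫∫φ_j`, the row sums
`r(a) = ∫K(a,b)db − t`, `d_j(a) = ∫φ_j(a,b)db − m_j`, and `ε′ = |J|³c³/3 + 2ε`:

* `abs_mean_sub_thirdOrder_le` — `|t − (1 + J m₁ + (J²/2) m₂ + (J³/6) m₃)| ≤ ε`;
* `abs_row_sub_thirdOrder_le` — `|r(a) − (J d₁(a) + (J²/2) d₂(a))| ≤ ε′`;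
* **`abs_rowVariance_sub_thirdOrder_le`** — `|∫ r² − (J² ∫ d₁² + J³ ∫ d₁ d₂)| ≤ ε′(4|J|c + 2J²c² + ε′) + J⁴c⁴`;
* **`abs_rowKernelRow_sub_thirdOrder_le`** — the new third-order scalar `⟪w, T w⟫ = ∫_a r(a) ∫_b K(a,b) r(b)`:
  `|∫_a r(a) ∫_b K(a,b) r(b) − J³ ∫∫ d₁(a) φ₁(a,b) d₁(b)| ≤ ρ²(J²c²/2 + |J|³c³/6 + ε) + (J²c² + ε′)|J|c ρ + 2J²c²(J²c² + ε′)`,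
  `ρ = 2|J|c + J²c² + ε′` (because `∫ r = 0`, only `K − 1 = J φ₁ + O(J²)` enters, and the leading term is cubic).

All integrals are against the same probability measure; `K, φ₁, φ₂, φ₃` jointly measurable and bounded. [folklore]
-/

noncomputable section

open MeasureTheory Function

namespace Summit.Ventures.YMGap.FlowData

section KernelThirdOrder

variable {X : Type*} [MeasurableSpace X] {μ : Measure X} [IsProbabilityMeasure μ]
  {K φ₁ φ₂ φ₃ : X → X → ℝ} {J c ε CK : ℝ}

/-- A bounded measurable real function on a probability space is integrable. [folklore] -/
private theorem kto_integrable {f : X → ℝ} (hf : Measurable f) {C : ℝ} (hC : ∀ x, |f x| ≤ C) : Integrable f μ :=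
  Integrable.of_bound hf.aestronglyMeasurable C (ae_of_all _ fun x => by rw [Real.norm_eq_abs]; exact hC x)

/-- `|∫ f| ≤ C` if `|f| ≤ C` pointwise (probability measure). [folklore] -/
private theorem kto_abs_integral_le {f : X → ℝ} {C : ℝ} (hC : ∀ x, |f x| ≤ C) : |∫ x, f x ∂μ| ≤ C := by
  have h := norm_integral_le_of_norm_le_const (μ := μ) (f := f) (C := C) (ae_of_all _ fun x => by
    rw [Real.norm_eq_abs]; exact hC x)
  rwa [Real.norm_eq_abs, probReal_univ, mul_one] at h

/-- Measurability of a row integral `a ↦ ∫ F(a,b) db` of a jointly measurable function. [folklore] -/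
private theorem kto_measurable_row {F : X → X → ℝ} (hF : StronglyMeasurable (uncurry F)) :
    Measurable fun a => ∫ b, F a b ∂μ :=
  (MeasureTheory.StronglyMeasurable.integral_prod_right (ν := μ) hF).measurable

/-- Measurability of a section `b ↦ F(a,b)`. [folklore] -/
private theorem kto_measurable_sec {F : X → X → ℝ} (hF : StronglyMeasurable (uncurry F)) (a : X) :
    Measurable fun b => F a b :=
  hF.measurable.comp (measurable_const.prodMk measurable_id)

/-- The row of the kernel to third order: `|∫K(a,·) − (1 + J∫φ₁(a,·) + (J²/2)∫φ₂(a,·) + (J³/6)∫φ₃(a,·))| ≤ ε`. [folklore] -/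
theorem abs_rowIntegral_sub_thirdOrder_le (hK : StronglyMeasurable (uncurry K)) (hφ₁ : StronglyMeasurable (uncurry φ₁))
    (hφ₂ : StronglyMeasurable (uncurry φ₂)) (hφ₃ : StronglyMeasurable (uncurry φ₃)) (hKb : ∀ a b, |K a b| ≤ CK)
    (hφ₁b : ∀ a b, |φ₁ a b| ≤ c) (hφ₂b : ∀ a b, |φ₂ a b| ≤ c ^ 2) (hφ₃b : ∀ a b, |φ₃ a b| ≤ c ^ 3)
    (hrem : ∀ a b, |K a b - 1 - J * φ₁ a b - J ^ 2 / 2 * φ₂ a b - J ^ 3 / 6 * φ₃ a b| ≤ ε) (a : X) :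
    |(∫ b, K a b ∂μ) - (1 + J * ∫ b, φ₁ a b ∂μ + J ^ 2 / 2 * ∫ b, φ₂ a b ∂μ + J ^ 3 / 6 * ∫ b, φ₃ a b ∂μ)| ≤ ε := by
  have iK : Integrable (fun b => K a b) μ := kto_integrable (kto_measurable_sec hK a) (fun b => hKb a b)
  have i1 : Integrable (fun b => φ₁ a b) μ := kto_integrable (kto_measurable_sec hφ₁ a) (fun b => hφ₁b a b)
  have i2 : Integrable (fun b => φ₂ a b) μ := kto_integrable (kto_measurable_sec hφ₂ a) (fun b => hφ₂b a b)
  have i3 : Integrable (fun b => φ₃ a b) μ := kto_integrable (kto_measurable_sec hφ₃ a) (fun b => hφ₃b a b)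
  have i1J : Integrable (fun b => J * φ₁ a b) μ := i1.const_mul J
  have i2J : Integrable (fun b => J ^ 2 / 2 * φ₂ a b) μ := i2.const_mul _
  have i3J : Integrable (fun b => J ^ 3 / 6 * φ₃ a b) μ := i3.const_mul _
  have iK1 : Integrable (fun b => K a b - 1) μ := iK.sub (integrable_const _)
  have iK1J : Integrable (fun b => K a b - 1 - J * φ₁ a b) μ := iK1.sub i1J
  have iK2J : Integrable (fun b => K a b - 1 - J * φ₁ a b - J ^ 2 / 2 * φ₂ a b) μ := iK1J.sub i2J
  have heq : (∫ b, K a b ∂μ) - (1 + J * ∫ b, φ₁ a b ∂μ + J ^ 2 / 2 * ∫ b, φ₂ a b ∂μ + J ^ 3 / 6 * ∫ b, φ₃ a b ∂μ) =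
      ∫ b, (K a b - 1 - J * φ₁ a b - J ^ 2 / 2 * φ₂ a b - J ^ 3 / 6 * φ₃ a b) ∂μ := by
    rw [integral_sub iK2J i3J, integral_sub iK1J i2J, integral_sub iK1 i1J, integral_sub iK (integrable_const _),
      integral_const_mul, integral_const_mul, integral_const_mul, integral_const, probReal_univ, one_smul]
    ring
  rw [heq]
  exact kto_abs_integral_le fun b => hrem a b

/-- **Mean of the kernel to third order**: `|∫∫K − (1 + J m₁ + (J²/2) m₂ + (J³/6) m₃)| ≤ ε`. [folklore] -/
theorem abs_mean_sub_thirdOrder_le (hK : StronglyMeasurable (uncurry K)) (hφ₁ : StronglyMeasurable (uncurry φ₁))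
    (hφ₂ : StronglyMeasurable (uncurry φ₂)) (hφ₃ : StronglyMeasurable (uncurry φ₃)) (hKb : ∀ a b, |K a b| ≤ CK)
    (hφ₁b : ∀ a b, |φ₁ a b| ≤ c) (hφ₂b : ∀ a b, |φ₂ a b| ≤ c ^ 2) (hφ₃b : ∀ a b, |φ₃ a b| ≤ c ^ 3)
    (hrem : ∀ a b, |K a b - 1 - J * φ₁ a b - J ^ 2 / 2 * φ₂ a b - J ^ 3 / 6 * φ₃ a b| ≤ ε) :
    |(∫ a, ∫ b, K a b ∂μ ∂μ) - (1 + J * ∫ a, ∫ b, φ₁ a b ∂μ ∂μ + J ^ 2 / 2 * ∫ a, ∫ b, φ₂ a b ∂μ ∂μ +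
        J ^ 3 / 6 * ∫ a, ∫ b, φ₃ a b ∂μ ∂μ)| ≤ ε := by
  have hrow := abs_rowIntegral_sub_thirdOrder_le (μ := μ) hK hφ₁ hφ₂ hφ₃ hKb hφ₁b hφ₂b hφ₃b hrem
  have iK : Integrable (fun a => ∫ b, K a b ∂μ) μ :=
    kto_integrable (kto_measurable_row hK) fun a => kto_abs_integral_le fun b => hKb a b
  have i1 : Integrable (fun a => ∫ b, φ₁ a b ∂μ) μ :=
    kto_integrable (kto_measurable_row hφ₁) fun a => kto_abs_integral_le fun b => hφ₁b a b
  have i2 : Integrable (fun a => ∫ b, φ₂ a b ∂μ) μ :=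
    kto_integrable (kto_measurable_row hφ₂) fun a => kto_abs_integral_le fun b => hφ₂b a b
  have i3 : Integrable (fun a => ∫ b, φ₃ a b ∂μ) μ :=
    kto_integrable (kto_measurable_row hφ₃) fun a => kto_abs_integral_le fun b => hφ₃b a b
  have i1J : Integrable (fun a => J * ∫ b, φ₁ a b ∂μ) μ := i1.const_mul J
  have i2J : Integrable (fun a => J ^ 2 / 2 * ∫ b, φ₂ a b ∂μ) μ := i2.const_mul _
  have i3J : Integrable (fun a => J ^ 3 / 6 * ∫ b, φ₃ a b ∂μ) μ := i3.const_mul _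
  have i01 : Integrable (fun a => (1 : ℝ) + J * ∫ b, φ₁ a b ∂μ) μ := (integrable_const _).add i1J
  have i012 : Integrable (fun a => (1 : ℝ) + J * ∫ b, φ₁ a b ∂μ + J ^ 2 / 2 * ∫ b, φ₂ a b ∂μ) μ := i01.add i2J
  have i0123 : Integrable (fun a => (1 : ℝ) + J * ∫ b, φ₁ a b ∂μ + J ^ 2 / 2 * ∫ b, φ₂ a b ∂μ +
      J ^ 3 / 6 * ∫ b, φ₃ a b ∂μ) μ := i012.add i3J
  have heq : (∫ a, ∫ b, K a b ∂μ ∂μ) - (1 + J * ∫ a, ∫ b, φ₁ a b ∂μ ∂μ + J ^ 2 / 2 * ∫ a, ∫ b, φ₂ a b ∂μ ∂μ +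
        J ^ 3 / 6 * ∫ a, ∫ b, φ₃ a b ∂μ ∂μ) =
      ∫ a, ((∫ b, K a b ∂μ) - (1 + J * ∫ b, φ₁ a b ∂μ + J ^ 2 / 2 * ∫ b, φ₂ a b ∂μ + J ^ 3 / 6 * ∫ b, φ₃ a b ∂μ)) ∂μ := by
    rw [integral_sub iK i0123, integral_add i012 i3J, integral_add i01 i2J, integral_add (integrable_const _) i1J,
      integral_const_mul, integral_const_mul, integral_const_mul, integral_const, probReal_univ, one_smul]
  rw [heq]
  exact kto_abs_integral_le hrow

/-- **Centred row integrals to second order**: with `t = ∫∫K`, `m_j = ∫∫φ_j`,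
`|(∫K(a,·) − t) − (J(∫φ₁(a,·) − m₁) + (J²/2)(∫φ₂(a,·) − m₂))| ≤ |J|³c³/3 + 2ε`. [folklore] -/
theorem abs_row_sub_thirdOrder_le (hK : StronglyMeasurable (uncurry K)) (hφ₁ : StronglyMeasurable (uncurry φ₁))
    (hφ₂ : StronglyMeasurable (uncurry φ₂)) (hφ₃ : StronglyMeasurable (uncurry φ₃)) (hKb : ∀ a b, |K a b| ≤ CK)
    (hφ₁b : ∀ a b, |φ₁ a b| ≤ c) (hφ₂b : ∀ a b, |φ₂ a b| ≤ c ^ 2) (hφ₃b : ∀ a b, |φ₃ a b| ≤ c ^ 3)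
    (hrem : ∀ a b, |K a b - 1 - J * φ₁ a b - J ^ 2 / 2 * φ₂ a b - J ^ 3 / 6 * φ₃ a b| ≤ ε) (a : X) :
    |((∫ b, K a b ∂μ) - ∫ a, ∫ b, K a b ∂μ ∂μ) - (J * ((∫ b, φ₁ a b ∂μ) - ∫ a, ∫ b, φ₁ a b ∂μ ∂μ) +
        J ^ 2 / 2 * ((∫ b, φ₂ a b ∂μ) - ∫ a, ∫ b, φ₂ a b ∂μ ∂μ))| ≤ |J| ^ 3 * c ^ 3 / 3 + 2 * ε := by
  have hrow := abs_rowIntegral_sub_thirdOrder_le (μ := μ) hK hφ₁ hφ₂ hφ₃ hKb hφ₁b hφ₂b hφ₃b hrem a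
  have hmean := abs_mean_sub_thirdOrder_le (μ := μ) hK hφ₁ hφ₂ hφ₃ hKb hφ₁b hφ₂b hφ₃b hrem
  have h3a : |J ^ 3 / 6 * ∫ b, φ₃ a b ∂μ| ≤ |J| ^ 3 * c ^ 3 / 6 := by
    rw [abs_mul, abs_div, abs_pow, abs_of_pos (by norm_num : (0:ℝ) < 6)]
    have := mul_le_mul_of_nonneg_left (kto_abs_integral_le (μ := μ) fun b => hφ₃b a b) (by positivity : (0:ℝ) ≤ |J| ^ 3 / 6)
    linarith
  have h3m : |J ^ 3 / 6 * ∫ a, ∫ b, φ₃ a b ∂μ ∂μ| ≤ |J| ^ 3 * c ^ 3 / 6 := by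
    rw [abs_mul, abs_div, abs_pow, abs_of_pos (by norm_num : (0:ℝ) < 6)]
    have := mul_le_mul_of_nonneg_left
      (kto_abs_integral_le (μ := μ) fun a => kto_abs_integral_le (μ := μ) fun b => hφ₃b a b)
      (by positivity : (0:ℝ) ≤ |J| ^ 3 / 6)
    linarith
  have key : ((∫ b, K a b ∂μ) - ∫ a, ∫ b, K a b ∂μ ∂μ) - (J * ((∫ b, φ₁ a b ∂μ) - ∫ a, ∫ b, φ₁ a b ∂μ ∂μ) +
        J ^ 2 / 2 * ((∫ b, φ₂ a b ∂μ) - ∫ a, ∫ b, φ₂ a b ∂μ ∂μ)) =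
      ((∫ b, K a b ∂μ) - (1 + J * ∫ b, φ₁ a b ∂μ + J ^ 2 / 2 * ∫ b, φ₂ a b ∂μ + J ^ 3 / 6 * ∫ b, φ₃ a b ∂μ)) -
        ((∫ a, ∫ b, K a b ∂μ ∂μ) - (1 + J * ∫ a, ∫ b, φ₁ a b ∂μ ∂μ + J ^ 2 / 2 * ∫ a, ∫ b, φ₂ a b ∂μ ∂μ +
          J ^ 3 / 6 * ∫ a, ∫ b, φ₃ a b ∂μ ∂μ)) +
        J ^ 3 / 6 * (∫ b, φ₃ a b ∂μ) - J ^ 3 / 6 * ∫ a, ∫ b, φ₃ a b ∂μ ∂μ := by ring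
  rw [key]
  obtain ⟨h1l, h1u⟩ := abs_le.1 hrow
  obtain ⟨h2l, h2u⟩ := abs_le.1 hmean
  obtain ⟨h3l, h3u⟩ := abs_le.1 h3a
  obtain ⟨h4l, h4u⟩ := abs_le.1 h3m
  exact abs_le.2 ⟨by linarith, by linarith⟩

/-- **Row variance to third order**: with `r(a) = ∫K(a,·) − t`, `d_j(a) = ∫φ_j(a,·) − m_j`, `ε′ = |J|³c³/3 + 2ε`:
`|∫ r² − (J² ∫ d₁² + J³ ∫ d₁ d₂)| ≤ ε′ (4|J|c + 2J²c² + ε′) + J⁴c⁴`. [folklore] -/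
theorem abs_rowVariance_sub_thirdOrder_le (hK : StronglyMeasurable (uncurry K)) (hφ₁ : StronglyMeasurable (uncurry φ₁))
    (hφ₂ : StronglyMeasurable (uncurry φ₂)) (hφ₃ : StronglyMeasurable (uncurry φ₃)) (hKb : ∀ a b, |K a b| ≤ CK)
    (hφ₁b : ∀ a b, |φ₁ a b| ≤ c) (hφ₂b : ∀ a b, |φ₂ a b| ≤ c ^ 2) (hφ₃b : ∀ a b, |φ₃ a b| ≤ c ^ 3)
    (hrem : ∀ a b, |K a b - 1 - J * φ₁ a b - J ^ 2 / 2 * φ₂ a b - J ^ 3 / 6 * φ₃ a b| ≤ ε) :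
    |(∫ a, ((∫ b, K a b ∂μ) - ∫ a, ∫ b, K a b ∂μ ∂μ) ^ 2 ∂μ) -
        (J ^ 2 * ∫ a, ((∫ b, φ₁ a b ∂μ) - ∫ a, ∫ b, φ₁ a b ∂μ ∂μ) ^ 2 ∂μ +
          J ^ 3 * ∫ a, ((∫ b, φ₁ a b ∂μ) - ∫ a, ∫ b, φ₁ a b ∂μ ∂μ) *
            ((∫ b, φ₂ a b ∂μ) - ∫ a, ∫ b, φ₂ a b ∂μ ∂μ) ∂μ)| ≤
      (|J| ^ 3 * c ^ 3 / 3 + 2 * ε) * (4 * |J| * c + 2 * J ^ 2 * c ^ 2 + (|J| ^ 3 * c ^ 3 / 3 + 2 * ε)) +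
        J ^ 4 * c ^ 4 := by
  set t : ℝ := ∫ a, ∫ b, K a b ∂μ ∂μ with ht
  set m₁ : ℝ := ∫ a, ∫ b, φ₁ a b ∂μ ∂μ with hm₁
  set m₂ : ℝ := ∫ a, ∫ b, φ₂ a b ∂μ ∂μ with hm₂
  set r : X → ℝ := fun a => (∫ b, K a b ∂μ) - t with hr
  set d₁ : X → ℝ := fun a => (∫ b, φ₁ a b ∂μ) - m₁ with hd₁
  set d₂ : X → ℝ := fun a => (∫ b, φ₂ a b ∂μ) - m₂ with hd₂
  set ε' : ℝ := |J| ^ 3 * c ^ 3 / 3 + 2 * ε with hε'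
  obtain ⟨x₀⟩ : Nonempty X := nonempty_of_isProbabilityMeasure μ
  have hc0 : 0 ≤ c := (abs_nonneg _).trans (hφ₁b x₀ x₀)
  have hε0 : 0 ≤ ε := (abs_nonneg _).trans (hrem x₀ x₀)
  -- pointwise data
  have hrd : ∀ a, |r a - (J * d₁ a + J ^ 2 / 2 * d₂ a)| ≤ ε' := fun a =>
    abs_row_sub_thirdOrder_le (μ := μ) hK hφ₁ hφ₂ hφ₃ hKb hφ₁b hφ₂b hφ₃b hrem a
  have hd₁b : ∀ a, |d₁ a| ≤ 2 * c := fun a => by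
    calc |(∫ b, φ₁ a b ∂μ) - m₁| ≤ |∫ b, φ₁ a b ∂μ| + |m₁| := abs_sub _ _
      _ ≤ c + c := add_le_add (kto_abs_integral_le fun b => hφ₁b a b)
          (kto_abs_integral_le fun a => kto_abs_integral_le fun b => hφ₁b a b)
      _ = 2 * c := by ring
  have hd₂b : ∀ a, |d₂ a| ≤ 2 * c ^ 2 := fun a => by
    calc |(∫ b, φ₂ a b ∂μ) - m₂| ≤ |∫ b, φ₂ a b ∂μ| + |m₂| := abs_sub _ _
      _ ≤ c ^ 2 + c ^ 2 := add_le_add (kto_abs_integral_le fun b => hφ₂b a b)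
          (kto_abs_integral_le fun a => kto_abs_integral_le fun b => hφ₂b a b)
      _ = 2 * c ^ 2 := by ring
  have hpb : ∀ a, |J * d₁ a + J ^ 2 / 2 * d₂ a| ≤ 2 * |J| * c + J ^ 2 * c ^ 2 := fun a => by
    calc |J * d₁ a + J ^ 2 / 2 * d₂ a| ≤ |J * d₁ a| + |J ^ 2 / 2 * d₂ a| := abs_add_le _ _
      _ ≤ |J| * (2 * c) + J ^ 2 / 2 * (2 * c ^ 2) := by
          rw [abs_mul, abs_mul, abs_of_nonneg (by positivity : (0:ℝ) ≤ J ^ 2 / 2)]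
          exact add_le_add (mul_le_mul_of_nonneg_left (hd₁b a) (abs_nonneg _))
            (mul_le_mul_of_nonneg_left (hd₂b a) (by positivity))
      _ = 2 * |J| * c + J ^ 2 * c ^ 2 := by ring
  -- pointwise: `r² − (J²d₁² + J³d₁d₂) = (r − p)(r + p) + (J⁴/4) d₂²`, `p = J d₁ + (J²/2) d₂`
  have hpt : ∀ a, |r a ^ 2 - (J ^ 2 * d₁ a ^ 2 + J ^ 3 * (d₁ a * d₂ a))| ≤
      ε' * (4 * |J| * c + 2 * J ^ 2 * c ^ 2 + ε') + J ^ 4 * c ^ 4 := by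
    intro a
    have e : r a ^ 2 - (J ^ 2 * d₁ a ^ 2 + J ^ 3 * (d₁ a * d₂ a)) =
        (r a - (J * d₁ a + J ^ 2 / 2 * d₂ a)) * (r a + (J * d₁ a + J ^ 2 / 2 * d₂ a)) +
          J ^ 4 / 4 * d₂ a ^ 2 := by ring
    rw [e]
    refine (abs_add_le _ _).trans (add_le_add ?_ ?_)
    · rw [abs_mul]
      refine mul_le_mul (hrd a) ?_ (abs_nonneg _) (by positivity)
      have e2 : r a + (J * d₁ a + J ^ 2 / 2 * d₂ a) =
          (r a - (J * d₁ a + J ^ 2 / 2 * d₂ a)) + 2 * (J * d₁ a + J ^ 2 / 2 * d₂ a) := by ring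
      rw [e2]
      calc |(r a - (J * d₁ a + J ^ 2 / 2 * d₂ a)) + 2 * (J * d₁ a + J ^ 2 / 2 * d₂ a)|
          ≤ |r a - (J * d₁ a + J ^ 2 / 2 * d₂ a)| + |2 * (J * d₁ a + J ^ 2 / 2 * d₂ a)| := abs_add_le _ _
        _ ≤ ε' + 2 * (2 * |J| * c + J ^ 2 * c ^ 2) := by
            rw [abs_mul, abs_two]
            exact add_le_add (hrd a) (mul_le_mul_of_nonneg_left (hpb a) zero_le_two)
        _ = 4 * |J| * c + 2 * J ^ 2 * c ^ 2 + ε' := by ring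
    · rw [abs_mul, abs_of_nonneg (by positivity : (0:ℝ) ≤ J ^ 4 / 4), abs_pow]
      calc J ^ 4 / 4 * |d₂ a| ^ 2 ≤ J ^ 4 / 4 * (2 * c ^ 2) ^ 2 :=
            mul_le_mul_of_nonneg_left (pow_le_pow_left₀ (abs_nonneg _) (hd₂b a) 2) (by positivity)
        _ = J ^ 4 * c ^ 4 := by ring
  -- integrate
  have mr : Measurable r := (kto_measurable_row hK).sub measurable_const
  have md₁ : Measurable d₁ := (kto_measurable_row hφ₁).sub measurable_const
  have md₂ : Measurable d₂ := (kto_measurable_row hφ₂).sub measurable_const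
  have hrb : ∀ a, |r a| ≤ CK + |t| := fun a => by
    exact (abs_sub _ _).trans (add_le_add (kto_abs_integral_le fun b => hKb a b) le_rfl)
  have ir2 : Integrable (fun a => r a ^ 2) μ :=
    kto_integrable (mr.pow_const 2) (C := (CK + |t|) ^ 2) fun a => by
      rw [abs_pow]; exact pow_le_pow_left₀ (abs_nonneg _) (hrb a) 2
  have id2 : Integrable (fun a => J ^ 2 * d₁ a ^ 2) μ :=
    (kto_integrable (md₁.pow_const 2) (C := (2 * c) ^ 2) fun a => by
      rw [abs_pow]; exact pow_le_pow_left₀ (abs_nonneg _) (hd₁b a) 2).const_mul _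
  have md12 : Measurable fun a => d₁ a * d₂ a := md₁.mul md₂
  have id12' : Integrable (fun a => d₁ a * d₂ a) μ :=
    kto_integrable md12 (C := 2 * c * (2 * c ^ 2)) fun a => by
      rw [abs_mul]; exact mul_le_mul (hd₁b a) (hd₂b a) (abs_nonneg _) (by positivity)
  have id12 : Integrable (fun a => J ^ 3 * (d₁ a * d₂ a)) μ := id12'.const_mul _
  have iadd : Integrable (fun a => J ^ 2 * d₁ a ^ 2 + J ^ 3 * (d₁ a * d₂ a)) μ := id2.add id12
  have heq : (∫ a, r a ^ 2 ∂μ) - (J ^ 2 * ∫ a, d₁ a ^ 2 ∂μ + J ^ 3 * ∫ a, d₁ a * d₂ a ∂μ) =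
      ∫ a, (r a ^ 2 - (J ^ 2 * d₁ a ^ 2 + J ^ 3 * (d₁ a * d₂ a))) ∂μ := by
    rw [integral_sub ir2 iadd, integral_add id2 id12, integral_const_mul, integral_const_mul]
  show |(∫ a, r a ^ 2 ∂μ) - (J ^ 2 * ∫ a, d₁ a ^ 2 ∂μ + J ^ 3 * ∫ a, d₁ a * d₂ a ∂μ)| ≤ _
  rw [heq]
  exact kto_abs_integral_le hpt

/-- **The scalar `⟪w, T w⟫ = ∫_a r(a) ∫_b K(a,b) r(b)` to third order**: with `r(a) = ∫K(a,·) − t`, `d₁(a) = ∫φ₁(a,·) − m₁`,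
`ε′ = |J|³c³/3 + 2ε`, `ρ = 2|J|c + J²c² + ε′`:
`|∫_a r(a) ∫_b K(a,b) r(b) − J³ ∫∫ d₁(a) φ₁(a,b) d₁(b)| ≤ ρ²(J²c²/2 + |J|³c³/6 + ε) + (J²c² + ε′)|J|c ρ + 2J²c²(J²c² + ε′)`
(`∫ r = 0`, so `K` may be replaced by `K − 1 = J φ₁ + O(J²)`). [folklore] -/
theorem abs_rowKernelRow_sub_thirdOrder_le (hK : StronglyMeasurable (uncurry K)) (hφ₁ : StronglyMeasurable (uncurry φ₁))
    (hφ₂ : StronglyMeasurable (uncurry φ₂)) (hKb : ∀ a b, |K a b| ≤ CK)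
    (hφ₁b : ∀ a b, |φ₁ a b| ≤ c) (hφ₂b : ∀ a b, |φ₂ a b| ≤ c ^ 2) (hφ₃b : ∀ a b, |φ₃ a b| ≤ c ^ 3)
    (hrem : ∀ a b, |K a b - 1 - J * φ₁ a b - J ^ 2 / 2 * φ₂ a b - J ^ 3 / 6 * φ₃ a b| ≤ ε) :
    |(∫ a, ((∫ b, K a b ∂μ) - ∫ a, ∫ b, K a b ∂μ ∂μ) *
          (∫ b, K a b * ((∫ b', K b b' ∂μ) - ∫ a, ∫ b, K a b ∂μ ∂μ) ∂μ) ∂μ) -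
        J ^ 3 * ∫ a, ∫ b, ((∫ b', φ₁ a b' ∂μ) - ∫ a, ∫ b, φ₁ a b ∂μ ∂μ) * φ₁ a b *
          ((∫ b', φ₁ b b' ∂μ) - ∫ a, ∫ b, φ₁ a b ∂μ ∂μ) ∂μ ∂μ| ≤
      (2 * |J| * c + J ^ 2 * c ^ 2 + (|J| ^ 3 * c ^ 3 / 3 + 2 * ε)) ^ 2 * (J ^ 2 * c ^ 2 / 2 + |J| ^ 3 * c ^ 3 / 6 + ε) +
        (J ^ 2 * c ^ 2 + (|J| ^ 3 * c ^ 3 / 3 + 2 * ε)) * (|J| * c) *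
          (2 * |J| * c + J ^ 2 * c ^ 2 + (|J| ^ 3 * c ^ 3 / 3 + 2 * ε)) +
        2 * (|J| * c) * (|J| * c) * (J ^ 2 * c ^ 2 + (|J| ^ 3 * c ^ 3 / 3 + 2 * ε)) := by
  set t : ℝ := ∫ a, ∫ b, K a b ∂μ ∂μ with ht
  set m₁ : ℝ := ∫ a, ∫ b, φ₁ a b ∂μ ∂μ with hm₁
  set r : X → ℝ := fun a => (∫ b, K a b ∂μ) - t with hr
  set d₁ : X → ℝ := fun a => (∫ b, φ₁ a b ∂μ) - m₁ with hd₁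
  set ε' : ℝ := |J| ^ 3 * c ^ 3 / 3 + 2 * ε with hε'
  set ρ : ℝ := 2 * |J| * c + J ^ 2 * c ^ 2 + ε' with hρ
  obtain ⟨x₀⟩ : Nonempty X := nonempty_of_isProbabilityMeasure μ
  have hc0 : 0 ≤ c := (abs_nonneg _).trans (hφ₁b x₀ x₀)
  have hε0 : 0 ≤ ε := (abs_nonneg _).trans (hrem x₀ x₀)
  have hε'0 : 0 ≤ ε' := by positivity
  -- the second-order remainder and the first-order row statement of `KernelMeanVarianceExpansion`
  have hrem₂ : ∀ a b, |K a b - 1 - J * φ₁ a b - J ^ 2 / 2 * φ₂ a b| ≤ ε + |J| ^ 3 * c ^ 3 / 6 := fun a b => by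
    have e : K a b - 1 - J * φ₁ a b - J ^ 2 / 2 * φ₂ a b =
        (K a b - 1 - J * φ₁ a b - J ^ 2 / 2 * φ₂ a b - J ^ 3 / 6 * φ₃ a b) + J ^ 3 / 6 * φ₃ a b := by ring
    rw [e]
    refine (abs_add_le _ _).trans (add_le_add (hrem a b) ?_)
    rw [abs_mul, abs_div, abs_pow, abs_of_pos (by norm_num : (0:ℝ) < 6)]
    have := mul_le_mul_of_nonneg_left (hφ₃b a b) (by positivity : (0:ℝ) ≤ |J| ^ 3 / 6)
    linarith
  have hrd : ∀ a, |r a - J * d₁ a| ≤ J ^ 2 * c ^ 2 + ε' := fun a => by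
    have h := abs_row_sub_le (μ := μ) hK hφ₁ hφ₂ hKb hφ₁b hφ₂b hrem₂ a
    refine h.trans (le_of_eq ?_)
    rw [hε']; ring
  have hR₁ : ∀ a b, |K a b - 1 - J * φ₁ a b| ≤ J ^ 2 * c ^ 2 / 2 + |J| ^ 3 * c ^ 3 / 6 + ε := fun a b => by
    have e : K a b - 1 - J * φ₁ a b = (K a b - 1 - J * φ₁ a b - J ^ 2 / 2 * φ₂ a b) + J ^ 2 / 2 * φ₂ a b := by ring
    rw [e]
    refine (abs_add_le _ _).trans ?_
    rw [abs_mul, abs_of_nonneg (by positivity : (0:ℝ) ≤ J ^ 2 / 2)]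
    have := mul_le_mul_of_nonneg_left (hφ₂b a b) (by positivity : (0:ℝ) ≤ J ^ 2 / 2)
    linarith [hrem₂ a b]
  have hd₁b : ∀ a, |d₁ a| ≤ 2 * c := fun a => by
    calc |(∫ b, φ₁ a b ∂μ) - m₁| ≤ |∫ b, φ₁ a b ∂μ| + |m₁| := abs_sub _ _
      _ ≤ c + c := add_le_add (kto_abs_integral_le fun b => hφ₁b a b)
          (kto_abs_integral_le fun a => kto_abs_integral_le fun b => hφ₁b a b)
      _ = 2 * c := by ring
  have hrb : ∀ a, |r a| ≤ ρ := fun a => by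
    have e : r a = (r a - J * d₁ a) + J * d₁ a := by ring
    rw [e, hρ]
    calc |(r a - J * d₁ a) + J * d₁ a| ≤ |r a - J * d₁ a| + |J * d₁ a| := abs_add_le _ _
      _ ≤ (J ^ 2 * c ^ 2 + ε') + |J| * (2 * c) := by
          rw [abs_mul]; exact add_le_add (hrd a) (mul_le_mul_of_nonneg_left (hd₁b a) (abs_nonneg _))
      _ = 2 * |J| * c + J ^ 2 * c ^ 2 + ε' := by ring
  have hρ0 : 0 ≤ ρ := (abs_nonneg _).trans (hrb x₀)
  -- measurability / integrability
  have mr : Measurable r := (kto_measurable_row hK).sub measurable_const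
  have md₁ : Measurable d₁ := (kto_measurable_row hφ₁).sub measurable_const
  have mKa : ∀ a, Measurable fun b => K a b := fun a => kto_measurable_sec hK a
  have mφa : ∀ a, Measurable fun b => φ₁ a b := fun a => kto_measurable_sec hφ₁ a
  have ir : Integrable r μ := kto_integrable mr hrb
  -- `∫ r = 0`
  have hr0 : ∫ a, r a ∂μ = 0 := by
    have iK : Integrable (fun a => ∫ b, K a b ∂μ) μ :=
      kto_integrable (kto_measurable_row hK) fun a => kto_abs_integral_le fun b => hKb a b
    show ∫ a, ((∫ b, K a b ∂μ) - t) ∂μ = 0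
    rw [integral_sub iK (integrable_const _), integral_const, probReal_univ, one_smul, ht, sub_self]
  -- `∫_b K(a,b) r(b) = ∫_b (K(a,b) − 1) r(b)`
  have hKr : ∀ a, ∫ b, K a b * r b ∂μ = ∫ b, (K a b - 1) * r b ∂μ := fun a => by
    have i1 : Integrable (fun b => K a b * r b) μ :=
      kto_integrable ((mKa a).mul mr) (C := CK * ρ) fun b => by
        rw [abs_mul]; exact mul_le_mul (hKb a b) (hrb b) (abs_nonneg _) ((abs_nonneg _).trans (hKb a b))
    have e : (fun b => (K a b - 1) * r b) = fun b => K a b * r b - r b := by funext b; ring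
    rw [e, integral_sub i1 ir, hr0, sub_zero]
  -- pointwise identity and bound for the double integrand
  have hpt : ∀ a b, |r a * ((K a b - 1) * r b) - J ^ 3 * (d₁ a * φ₁ a b * d₁ b)| ≤
      ρ ^ 2 * (J ^ 2 * c ^ 2 / 2 + |J| ^ 3 * c ^ 3 / 6 + ε) + (J ^ 2 * c ^ 2 + ε') * (|J| * c) * ρ +
        2 * (|J| * c) * (|J| * c) * (J ^ 2 * c ^ 2 + ε') := by
    intro a b
    have e : r a * ((K a b - 1) * r b) - J ^ 3 * (d₁ a * φ₁ a b * d₁ b) =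
        r a * (K a b - 1 - J * φ₁ a b) * r b + (r a - J * d₁ a) * (J * φ₁ a b) * r b +
          (J * d₁ a) * (J * φ₁ a b) * (r b - J * d₁ b) := by ring
    rw [e]
    have hJφ : |J * φ₁ a b| ≤ |J| * c := by rw [abs_mul]; exact mul_le_mul_of_nonneg_left (hφ₁b a b) (abs_nonneg _)
    have hJd : |J * d₁ a| ≤ 2 * (|J| * c) := by
      rw [abs_mul]
      calc |J| * |d₁ a| ≤ |J| * (2 * c) := mul_le_mul_of_nonneg_left (hd₁b a) (abs_nonneg _)
        _ = 2 * (|J| * c) := by ring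
    refine (abs_add_le _ _).trans (add_le_add ((abs_add_le _ _).trans (add_le_add ?_ ?_)) ?_)
    · rw [abs_mul, abs_mul]
      calc |r a| * |K a b - 1 - J * φ₁ a b| * |r b| ≤ ρ * (J ^ 2 * c ^ 2 / 2 + |J| ^ 3 * c ^ 3 / 6 + ε) * ρ :=
            mul_le_mul (mul_le_mul (hrb a) (hR₁ a b) (abs_nonneg _) hρ0) (hrb b) (abs_nonneg _) (by positivity)
        _ = ρ ^ 2 * (J ^ 2 * c ^ 2 / 2 + |J| ^ 3 * c ^ 3 / 6 + ε) := by ring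
    · rw [abs_mul, abs_mul]
      exact mul_le_mul (mul_le_mul (hrd a) hJφ (abs_nonneg _) (by positivity)) (hrb b) (abs_nonneg _)
        (by positivity)
    · rw [abs_mul, abs_mul]
      exact mul_le_mul (mul_le_mul hJd hJφ (abs_nonneg _) (by positivity)) (hrd b) (abs_nonneg _) (by positivity)
  -- integrability of the pieces
  have iKr : ∀ a, Integrable (fun b => (K a b - 1) * r b) μ := fun a =>
    kto_integrable (((mKa a).sub measurable_const).mul mr) (C := (CK + 1) * ρ) fun b => by
      rw [abs_mul]
      refine mul_le_mul ((abs_sub _ _).trans (add_le_add (hKb a b) (le_of_eq abs_one))) (hrb b) (abs_nonneg _) ?_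
      exact ((abs_nonneg _).trans (hKb a b)).trans (by linarith)
  have idφd : ∀ a, Integrable (fun b => d₁ a * φ₁ a b * d₁ b) μ := fun a =>
    kto_integrable ((measurable_const.mul (mφa a)).mul md₁) (C := 2 * c * c * (2 * c)) fun b => by
      rw [abs_mul, abs_mul]
      exact mul_le_mul (mul_le_mul (hd₁b a) (hφ₁b a b) (abs_nonneg _) (by positivity)) (hd₁b b) (abs_nonneg _)
        (by positivity)
  -- joint measurability for the outer integrals
  have hKr_joint : StronglyMeasurable (uncurry fun a b => (K a b - 1) * r b) := by
    have h1 : StronglyMeasurable (uncurry K - fun _ : X × X => (1 : ℝ)) := hK.sub stronglyMeasurable_const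
    have h2 : StronglyMeasurable fun p : X × X => r p.2 := (mr.comp measurable_snd).stronglyMeasurable
    exact h1.mul h2
  have hdφd_joint : StronglyMeasurable (uncurry fun a b => d₁ a * φ₁ a b * d₁ b) := by
    have h1 : StronglyMeasurable fun p : X × X => d₁ p.1 := (md₁.comp measurable_fst).stronglyMeasurable
    have h2 : StronglyMeasurable fun p : X × X => d₁ p.2 := (md₁.comp measurable_snd).stronglyMeasurable
    exact (h1.mul hφ₁).mul h2
  have mIKr : Measurable fun a => ∫ b, (K a b - 1) * r b ∂μ := kto_measurable_row hKr_joint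
  have mIdφd : Measurable fun a => ∫ b, d₁ a * φ₁ a b * d₁ b ∂μ := kto_measurable_row hdφd_joint
  have hIKr_b : ∀ a, |∫ b, (K a b - 1) * r b ∂μ| ≤ (CK + 1) * ρ := fun a =>
    kto_abs_integral_le fun b => by
      rw [abs_mul]
      refine mul_le_mul ((abs_sub _ _).trans (add_le_add (hKb a b) (le_of_eq abs_one))) (hrb b) (abs_nonneg _) ?_
      exact ((abs_nonneg _).trans (hKb a b)).trans (by linarith)
  have hIdφd_b : ∀ a, |∫ b, d₁ a * φ₁ a b * d₁ b ∂μ| ≤ 2 * c * c * (2 * c) := fun a =>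
    kto_abs_integral_le fun b => by
      rw [abs_mul, abs_mul]
      exact mul_le_mul (mul_le_mul (hd₁b a) (hφ₁b a b) (abs_nonneg _) (by positivity)) (hd₁b b) (abs_nonneg _)
        (by positivity)
  have iA : Integrable (fun a => r a * ∫ b, (K a b - 1) * r b ∂μ) μ :=
    kto_integrable (mr.mul mIKr) (C := ρ * ((CK + 1) * ρ)) fun a => by
      rw [abs_mul]; exact mul_le_mul (hrb a) (hIKr_b a) (abs_nonneg _) hρ0
  have iB : Integrable (fun a => J ^ 3 * ∫ b, d₁ a * φ₁ a b * d₁ b ∂μ) μ :=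
    (kto_integrable mIdφd hIdφd_b).const_mul _
  -- rewrite the statement as one double integral of the pointwise expression
  have hinner : ∀ a, r a * (∫ b, (K a b - 1) * r b ∂μ) - J ^ 3 * ∫ b, d₁ a * φ₁ a b * d₁ b ∂μ =
      ∫ b, (r a * ((K a b - 1) * r b) - J ^ 3 * (d₁ a * φ₁ a b * d₁ b)) ∂μ := fun a => by
    rw [← integral_const_mul, ← integral_const_mul, ← integral_sub ((iKr a).const_mul _) ((idφd a).const_mul _)]
  have heq : (∫ a, r a * (∫ b, K a b * r b ∂μ) ∂μ) - J ^ 3 * ∫ a, ∫ b, d₁ a * φ₁ a b * d₁ b ∂μ ∂μ =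
      ∫ a, ∫ b, (r a * ((K a b - 1) * r b) - J ^ 3 * (d₁ a * φ₁ a b * d₁ b)) ∂μ ∂μ := by
    simp_rw [hKr]
    rw [← integral_const_mul, ← integral_sub iA iB]
    exact integral_congr_ae (ae_of_all _ fun a => hinner a)
  show |(∫ a, r a * (∫ b, K a b * r b ∂μ) ∂μ) - J ^ 3 * ∫ a, ∫ b, d₁ a * φ₁ a b * d₁ b ∂μ ∂μ| ≤ _
  rw [heq]
  exact kto_abs_integral_le fun a => kto_abs_integral_le fun b => hpt a b

end KernelThirdOrder

end Summit.Ventures.YMGap.FlowData
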